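import Summits.BirchSwinnertonDyer.BirchSwinnertonDyer.Theorems.ResidualThetaTransportAtTwoRlfSharpEigenLocalFactor
import Summits.BirchSwinnertonDyer.BirchSwinnertonDyer.Theorems.ThetaPartnerAtTwoSignedTransportAtTwoSharpLocalGenerators
import Summits.BirchSwinnertonDyer.BirchSwinnertonDyer.Theorems.ThetaPartnerAtTwoSignedTransportAtTwoSharpLocalIndex
import Summits.BirchSwinnertonDyer.BirchSwinnertonDyer.Theorems.ThetaPartnerAtTwoSignedTransportAtTwoDecompositionCountAtTwo
import Summits.BirchSwinnertonDyer.BirchSwinnertonDyer.Theorems.ThetaPartnerAtTwoSignedTransportAtTwoSignedSelmerDescription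
import Literature.NumberTheory.EllipticCurves.Kobayashi2003.SignedTwistedInvariantsFiniteProofs
import HarnessLib

/-!
# Road T for item 23110, input H-FIN, part 3 (assembly at `ℚ`, `p = 2`): the `u`-eigenclasses of the `S₀`-imprimitive plus Selmer group
# `Sel♯_{S₀}(E/ℚ_∞)` have a uniform exponent for all but finitely many odd `u` — the hypothesis `hfinE` of
# `TwistedPT.hlevEventual_two_of_plusDualAlt_of_eigen` / `liftPlusEventual_two_of_plusDualAlt_of_eigen`

Route `ResidualThetaTransportAtTwo` (RTT, crux r201, stmt-BirchSwinnertonDyer-23110) / `ThetaPartnerAtTwo`; seat `prover-bsd-wall-tp2-p2x` g12 LEAD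
(`--supports stmt-BirchSwinnertonDyer-23110`). THEOREMS ONLY (no definition, no named fact, no `sorry`); closes nothing.

Greenberg (LNM 1716, §4 p. 124): «`S_{A_s}(F_∞)^Γ`, and hence `S_{A_s}(F)`, will be finite for all but finitely many values of `s`» — here for
the NON-PRIMITIVE signed Selmer group `Sel♯_{S₀}` (no condition at the odd places `S₀`, Kobayashi's plus condition at `2`), whose dual is
`Λ`-torsion because `X⁺` is (`D`) and the local factors at `v ∈ S₀` are cofinitely generated (p. 113). Proof: for odd `u` outside a finite set,
(i) the `u`-eigenclasses of `Sel⁺ = Sel♯_∅` are finite (`Kobayashi2003.SignedSelmerDualData.finite_setOf_int_infinite_conjH1_eq_zsmul`),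
(ii) at each `v ∈ S₀` the `u^{N_v}`-eigenvectors of the decomposition conjugation `conj_{δ_v}` on `X_v = H¹(H ∩ I_v, E[2^∞])` are finite
(`SharpEigen.finite_setOf_infinite_eigenspace_localFactor`, `finite_setOf_pow_mem`), (iii) the detecting map `c ↦ (r_v c)_{v ∈ S₀}` sends a
`u`-eigenclass of `Sel♯_{S₀}` to `u^{N_v}`-eigenvectors (`resH1Hom_inertiaInToH_eigen`, `γ^{N_v} = h_v·res g_v` from
`SignedEC.exists_localGenerator_two`) and its kernel on eigenclasses is `Sel♯_∅ = Sel⁺` (`detect_eq_zero_iff_mem_sharp_empty`,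
`signedSelmerInfty_eq_sharp_empty`); so the eigenclasses form a finite set, hence have a uniform exponent.

* **`finite_setOf_not_exists_uniformExponent_sharp_two`** — `{u : 2 ∣ u − 1 ∧ ¬ ∃ e, ∀ c ∈ Sel♯_{S₀}, conj_γ c = u•c → 2^e•c = 0}` is finite.

HONEST FRAMING: closes nothing; 23110 is NOT proved; BSD is not proved by any of this.
References: [GreenbergLNM1716] §4 pp. 113, 124; [GreenbergVatsal2000] §2 pp. 20–23; [Kobayashi2003] Def. 1.1, Thm. 1.2.
-/

-- the Theorems namespace of this sub repeats the summit name by design (D-0017 nested layout)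
set_option linter.dupNamespace false

noncomputable section

open scoped Classical Pointwise AddSubgroup
open CategoryTheory Function Topology
open _root_.Subgroup
open NumberField IsDedekindDomain Field
open Literature.NumberTheory.GaloisRepresentations
open Literature.NumberTheory.EllipticCurves Literature.NumberTheory.EllipticCurves.GreenbergSelmer
  Literature.NumberTheory.EllipticCurves.GreenbergVatsal2000 Literature.NumberTheory.EllipticCurves.Kobayashi2003
  Literature.NumberTheory.EllipticCurves.Rank1Residual
open Summit.BirchSwinnertonDyer.BirchSwinnertonDyer.Theorems.SignedTransportAtTwo

namespace Summit.BirchSwinnertonDyer.BirchSwinnertonDyer.Theorems.SignedEC.SharpEigen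

set_option maxHeartbeats 800000 in
/-- **H-FIN: uniform exponent of the `u`-eigenclasses of `Sel♯_{S₀}(E/ℚ_∞)` for all but finitely many odd `u`.** For `E/ℚ` globally minimal
with `Δ < 0`, `κ` cyclotomic with topological generator `γ`, `S₀` a finite set of odd places, and a Pontryagin dual datum `D` of
`Sel⁺(E/ℚ_∞)` with `D.X` finitely generated and `Λ`-TORSION: the set of odd `u` for which NO `2^e` kills every `c ∈ Sel♯_{S₀}` with
`conj_γ c = u • c` is finite. [cite: GreenbergLNM1716, §4 pp. 113, 124] [cite: GreenbergVatsal2000, §2 p. 20] -/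
theorem finite_setOf_not_exists_uniformExponent_sharp_two (E : WeierstrassCurve ℚ) [E.IsElliptic] [E.IsGloballyMinimal]
    (hΔ : E.Δ < 0) (κ : ZpExtension ℚ 2) (hκ : κ.IsCyclotomic) {γ : absoluteGaloisGroup ℚ} (hγ : κ.IsTopGenerator γ)
    (S₀ : Finset (HeightOneSpectrum (𝓞 ℚ))) (hS2 : ∀ v ∈ S₀, ((2 : ℕ) : 𝓞 ℚ) ∉ v.asIdeal)
    (D : SignedSelmerDualData E κ γ 1) [Module.Finite (IwasawaAlgebra 2) D.X] (hT : Module.IsTorsion (IwasawaAlgebra 2) D.X) :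
    {u : ℤ | (2 : ℤ) ∣ u - 1 ∧ ¬ ∃ e : ℕ, ∀ c ∈ unramifiedOutside κ.kerSubgroup ↥(E.geomPrimaryTorsion 2) 2 (↑S₀ : Set (HeightOneSpectrum (𝓞 ℚ))) ⊓
        ⨅ (v : HeightOneSpectrum (𝓞 ℚ)) (_ : ((2 : ℕ) : 𝓞 ℚ) ∈ v.asIdeal) (σ : absoluteGaloisGroup ℚ),
          (localKummerOverOfEmb E 2 κ.kerSubgroup (closureEmb (K := ℚ) (v.adicCompletion ℚ))
            (⨆ n : ℕ, signedLocalPoints κ (v.adicCompletion ℚ) E 1 n)).comap (E.conjH1 2 κ.kerSubgroup σ),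
      E.conjH1 2 κ.kerSubgroup γ c = u • c → 2 ^ e • c = 0}.Finite := by
  haveI : κ.kerSubgroup.Normal := by rw [ZpExtension.kerSubgroup]; infer_instance
  -- notation
  let H := κ.kerSubgroup
  let A := E.geomPrimaryTorsion 2
  let N : HeightOneSpectrum (𝓞 ℚ) → ℕ := fun v ↦ 2 ^ padicValNat 2 ((Rat.HeightOneSpectrum.natGenerator v ^ 2 - 1) / 8)
  let Sharp : AddSubgroup (E.subgroupH1 2 H) :=
    unramifiedOutside κ.kerSubgroup ↥(E.geomPrimaryTorsion 2) 2 (↑S₀ : Set (HeightOneSpectrum (𝓞 ℚ))) ⊓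
      ⨅ (v : HeightOneSpectrum (𝓞 ℚ)) (_ : ((2 : ℕ) : 𝓞 ℚ) ∈ v.asIdeal) (σ : absoluteGaloisGroup ℚ),
        (localKummerOverOfEmb E 2 κ.kerSubgroup (closureEmb (K := ℚ) (v.adicCompletion ℚ))
          (⨆ n : ℕ, signedLocalPoints κ (v.adicCompletion ℚ) E 1 n)).comap (E.conjH1 2 κ.kerSubgroup σ)
  -- the local generators `g_v` (`v ∈ S₀`), `γ^{N_v} = h_v · res g_v`
  have hgen : ∀ v : HeightOneSpectrum (𝓞 ℚ), ∃ g : absoluteGaloisGroup (v.adicCompletion ℚ), ((2 : ℕ) : 𝓞 ℚ) ∉ v.asIdeal →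
      ∃ h ∈ κ.kerSubgroup, γ ^ N v = h * resGal (K := ℚ) (v.adicCompletion ℚ) g := by
    intro v
    by_cases hpv : ((2 : ℕ) : 𝓞 ℚ) ∈ v.asIdeal
    · exact ⟨1, fun h ↦ absurd hpv h⟩
    · obtain ⟨s, g, h1, h2, h3, -, -⟩ := SignedEC.exists_localGenerator_two E κ hκ hγ v hpv
      have hs : s = padicValNat 2 (Rat.HeightOneSpectrum.natGenerator v ^ 2 - 1) - 3 :=
        SignedEC.localGenerator_exponent_eq κ hκ v hpv h3 h2
      have hℓprime : (Rat.HeightOneSpectrum.natGenerator v).Prime := Rat.HeightOneSpectrum.prime_natGenerator v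
      have hℓp : Rat.HeightOneSpectrum.natGenerator v ≠ 2 :=
        Summit.BirchSwinnertonDyer.Rank1Residual.X2.EulerFactorInvariants.natGenerator_ne_of_natCast_not_mem v hpv
      have hodd : Odd (Rat.HeightOneSpectrum.natGenerator v) := hℓprime.odd_of_ne_two hℓp
      have h8 : padicValNat 2 ((Rat.HeightOneSpectrum.natGenerator v ^ 2 - 1) / 8) =
          padicValNat 2 (Rat.HeightOneSpectrum.natGenerator v ^ 2 - 1) - 3 := by
        rw [show (8 : ℕ) = 2 ^ 3 by norm_num,
          padicValNat.div_pow ((SignedTransportAtTwo.eight_dvd_sq_sub_one hodd).trans (by norm_num))]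
      have hN : N v = 2 ^ s := by simp only [N, h8, hs]
      refine ⟨g, fun _ ↦ ?_⟩
      rw [hN]; exact h1
  choose g hg using hgen
  let δ : ∀ v : HeightOneSpectrum (𝓞 ℚ), decomp (K := ℚ) v := fun v ↦
    ⟨resGal (K := ℚ) (v.adicCompletion ℚ) (g v), (mem_decomp_iff v _).2 ⟨g v, rfl⟩⟩
  -- the finite exceptional sets
  have hB₁ := D.finite_setOf_int_infinite_conjH1_eq_zsmul hT
  have hBv : ∀ v ∈ S₀, {u : ℤ | u ^ N v ∈ {w : ℤ |
      haveI := inertiaIn_normal κ.kerSubgroup v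
      {x : discreteH1 (inertiaIn κ.kerSubgroup v) A |
        Literature.NumberTheory.EllipticCurves.conjH1 (inertiaIn κ.kerSubgroup v) A (δ v) x = w • x}.Infinite}}.Finite :=
    fun v hv ↦ finite_setOf_pow_mem (finite_setOf_infinite_eigenspace_localFactor κ v E hκ (hS2 v hv) (δ v))
      (Nat.one_le_two_pow)
  refine ((hB₁.union (S₀.finite_toSet.biUnion fun v hv ↦ hBv v hv)).subset ?_)
  rintro u ⟨hu, hnot⟩
  by_contra hmem
  rw [Set.mem_union, Set.mem_iUnion₂, not_or] at hmem
  push Not at hmem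
  obtain ⟨hm1, hm2⟩ := hmem
  apply hnot
  -- (i) finitely many `u`-eigenclasses in `Sel⁺`
  have hSfin : {s : signedSelmerInfty E κ 1 |
      E.conjH1 2 κ.kerSubgroup γ (s : E.subgroupH1 2 κ.kerSubgroup) = u • (s : E.subgroupH1 2 κ.kerSubgroup)}.Finite := by
    by_contra h
    exact hm1 ⟨hu, h⟩
  -- (ii) finitely many `u^{N_v}`-eigenvectors in `X_v`
  have hXfin : ∀ v ∈ S₀, haveI := inertiaIn_normal κ.kerSubgroup v
      {x : discreteH1 (inertiaIn κ.kerSubgroup v) A |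
        Literature.NumberTheory.EllipticCurves.conjH1 (inertiaIn κ.kerSubgroup v) A (δ v) x = u ^ N v • x}.Finite := by
    intro v hv
    by_contra h
    exact hm2 v hv h
  -- the eigenclasses of `Sel♯`
  set F : Set (E.subgroupH1 2 H) := {c | c ∈ Sharp ∧ E.conjH1 2 κ.kerSubgroup γ c = u • c} with hF
  -- the detecting map and its image
  let Ψ : E.subgroupH1 2 H → (∀ v : ↥S₀, discreteH1 (inertiaIn κ.kerSubgroup v.1) A) := fun c v ↦
    resH1Hom (inertiaInToH κ.kerSubgroup v.1) (AddMonoidHom.id A) (fun _ _ ↦ rfl) c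
  have hΨadd : ∀ c c' : E.subgroupH1 2 H, Ψ (c - c') = Ψ c - Ψ c' := fun c c' ↦ by
    funext v; simp only [Ψ, map_sub, Pi.sub_apply]
  let T : Set (∀ v : ↥S₀, discreteH1 (inertiaIn κ.kerSubgroup v.1) A) :=
    Set.univ.pi fun v : ↥S₀ ↦ haveI := inertiaIn_normal κ.kerSubgroup v.1
      {x : discreteH1 (inertiaIn κ.kerSubgroup v.1) A |
        Literature.NumberTheory.EllipticCurves.conjH1 (inertiaIn κ.kerSubgroup v.1) A (δ v.1) x = u ^ N v.1 • x}
  have hTfin : T.Finite := Set.Finite.pi fun v ↦ hXfin v.1 v.2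
  have hΨF : ∀ c ∈ F, Ψ c ∈ T := by
    rintro c ⟨-, hc⟩
    simp only [T, Set.mem_pi, Set.mem_univ, true_implies, Set.mem_setOf_eq]
    intro v
    obtain ⟨h, hh, hγN⟩ := hg v.1 (hS2 v.1 v.2)
    exact resH1Hom_inertiaInToH_eigen κ.kerSubgroup v.1 A hc (δ v.1) hh hγN
  -- the fibres of `Ψ` on `F` are finite: a difference of two eigenclasses with the same image lies in `Sel⁺`
  have hker : ∀ d ∈ F, Ψ d = 0 → d ∈ (signedSelmerInfty E κ 1 : AddSubgroup (E.subgroupH1 2 H)) := by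
    rintro d ⟨hdS, hdu⟩ hΨ
    rw [SignedTransportAtTwo.signedSelmerInfty_eq_sharp_empty E κ hκ hΔ]
    refine (detect_eq_zero_iff_mem_sharp_empty E κ 1 S₀ hS2 N
      (fun v hv σ ↦ SignedTransportAtTwo.forall_exists_lt_two' κ hκ hγ (hS2 v hv) σ) hdS).1 fun v hv n _ ↦ ?_
    have hpow := conjH1_pow_eq_zsmul_of_conjH1_eq_zsmul κ.kerSubgroup A hdu n
    change resH1Hom (inertiaInToH κ.kerSubgroup v) (AddMonoidHom.id A) (fun _ _ ↦ rfl)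
      (Literature.NumberTheory.EllipticCurves.conjH1 κ.kerSubgroup A (γ ^ n) d) = 0
    rw [hpow, map_zsmul]
    have h0 : resH1Hom (inertiaInToH κ.kerSubgroup v) (AddMonoidHom.id A) (fun _ _ ↦ rfl) d = 0 := by
      have := congr_fun hΨ ⟨v, hv⟩
      simpa [Ψ] using this
    rw [h0]
    exact zsmul_zero _
  have hFfin : F.Finite := by
    refine (hTfin.biUnion (t := fun t ↦ F ∩ Ψ ⁻¹' {t}) fun t _ ↦ ?_).subset fun c hc ↦ Set.mem_iUnion₂.2 ⟨Ψ c, hΨF c hc, hc, rfl⟩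
    -- each fibre is a translate of a subset of the finite set of `u`-eigenclasses of `Sel⁺`
    by_cases hne : (F ∩ Ψ ⁻¹' {t}).Nonempty
    · obtain ⟨c₀, hc₀F, hc₀t⟩ := hne
      refine (hSfin.image fun s : signedSelmerInfty E κ 1 ↦ (s : E.subgroupH1 2 H) + c₀).subset ?_
      rintro c ⟨hcF, hct⟩
      have hd : c - c₀ ∈ F := ⟨Sharp.sub_mem hcF.1 hc₀F.1, by rw [map_sub, hcF.2, hc₀F.2, zsmul_sub]⟩
      have hΨd : Ψ (c - c₀) = 0 := by
        rw [hΨadd]; simp only [Set.mem_preimage, Set.mem_singleton_iff] at hct hc₀t; rw [hct, hc₀t, sub_self]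
      have hdSel := hker _ hd hΨd
      refine ⟨⟨c - c₀, hdSel⟩, ?_, by simp⟩
      simp only [Set.mem_setOf_eq]
      exact hd.2
    · rw [Set.not_nonempty_iff_eq_empty.1 hne]; exact Set.finite_empty
  -- a uniform exponent on the finite set `F`
  have hk : ∀ c : E.subgroupH1 2 H, ∃ k : ℕ, 2 ^ k • c = 0 := fun c ↦ E.exists_pow_smul_subgroupH1_ker_eq_zero κ c
  choose k hk using hk
  obtain ⟨e, he⟩ := (hFfin.image k).bddAbove
  refine ⟨e, fun c hc heig ↦ ?_⟩
  have hcF : c ∈ F := ⟨hc, heig⟩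
  obtain ⟨d, hd⟩ := Nat.exists_eq_add_of_le (he (Set.mem_image_of_mem k hcF))
  rw [hd, pow_add, mul_comm, mul_smul, hk c, smul_zero]

end Summit.BirchSwinnertonDyer.BirchSwinnertonDyer.Theorems.SignedEC.SharpEigen

end
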